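import Summits.ResolutionOfSingularities.ResolutionOfSingularities.Theorems.LossEpisode3
import Summits.ResolutionOfSingularities.ResolutionOfSingularities.Theorems.LossShearRun
import HarnessLib

/-!
# LossDescent — the `β`-DESCENT assembly of the loss-episode automaton: two typed laws on the carrier imply
`NoRunStateOnLossyTail` (hence the located residual `NoLossyStrictTailsDeep`, `Theorems.LossEpisode3`)

decomp-res-lens-3, gen 28 (NODE-g28 rev 2 §6.4 (P4′) / §6.6).  TOOL at 0 (critic letter rows 220i–220k: the +1 is the hyp-free
measure on `NoRunStateOnLossyTail`; this file makes the remaining hypotheses EXPLICIT and TYPED).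

* §1 (M0) the `β`-LATTICE: `s! · β(Δ) ∈ ℕ` when the free letter carries no wall and the walls divide
  (`betaOf_polyPts_mul_factorial`; [CJS2020] proof of Thm 13.7: `β ∈ (1/n_N!)ℤ`), hence `s! · runBeta ∈ ℕ` at every run state of
  the tail (`runBeta_mul_factorial`).
* §2 the two OPEN laws as Props on the carrier of `Theorems.LossEpisode`:
  `LawX2At W N s` — an X2-arrow (same centre `(0:1:λ)` as X1 but the model's OTHER chart `l`; frame letters `j ↔ l` swap) does not
  raise `β` (= chart-transition invariance of the model `β`, NODE-g28 §6.3 F13 (vi) «unit rule»);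
  `LawLossEntryAt W N s` — after a total loss from a heavy run state there is a LATER heavy run state with strictly smaller `β`
  ([CJS2020] Lemma 13.3 `(1:0)` + Lemma 13.4 `(0:1)` through the loss chain; NODE-g28 §6.4 (L_loss)+(L_rep), §6.6 F14);
  closed forms `LawX2`, `LawLossEntry` (quantified exactly like `NoRunStateOnLossyTail`).
* §3 THE ASSEMBLY (PROVED): `runState_until_loss` (from a heavy run state follow R/X1/X2-arrows — laws (L_R) `runBeta_R_lt`,
  (L_X1) `runBeta_X1_le` PROVED in `Theorems.LossShearRun`, (L_X2) assumed — to the first total loss: `β` has not increased) and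
  `noRunStateOnLossyTail_of_laws : LawX2 → LawLossEntry → NoRunStateOnLossyTail` (infinite descent on `s!·β ∈ ℕ`), with the corollary
  `noLossyStrictTailsDeep_of_laws`.  So the located residual 27367 ⟸ `LawX2 ∧ LawLossEntry`, both statements about single arrows /
  single episodes of the carrier.
-/

open MvPolynomial Finset
open Literature.AlgebraicGeometry.Resolution
open Literature.AlgebraicGeometry.Resolution.Hauser2010
open Literature.AlgebraicGeometry.Resolution.PointBlowup
open Summit.ResolutionOfSingularities.ResolutionOfSingularities.Theorems.TightDefectClasses
open Summit.ResolutionOfSingularities.ResolutionOfSingularities.Theorems.TightDefectStrongWalks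
open Summit.ResolutionOfSingularities.ResolutionOfSingularities.Theorems.ItineraryCutClasses
open Summit.ResolutionOfSingularities.ResolutionOfSingularities.Theorems.BoundaryLedger
open Summit.ResolutionOfSingularities.ResolutionOfSingularities.Theorems.ProximityCut
open Summit.ResolutionOfSingularities.ResolutionOfSingularities.Theorems.WallCut
open Summit.ResolutionOfSingularities.ResolutionOfSingularities.Theorems.LossExitCone

/-! ## §1 (M0) The `β`-lattice -/

namespace Summit.ResolutionOfSingularities.ResolutionOfSingularities.Theorems.LossPolygon

variable {K : Type} [Field K] [DecidableEq K]

omit [DecidableEq K] in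
/-- **(M0) `s! · β ∈ ℕ`.**  If the free letter `c` carries no wall and the wall of the second letter divides every monomial,
the vertex ordinate `β = (D b − r b)/(s − D c)` of the residual point set has denominator `s − D c ∈ [1, s]`, so `s!·β ∈ ℕ`.
[CJS2020, proof of Thm 13.7 («`β_q ∈ (1/n_N!)ℤ²`», Lemma Vlattice); for the walk's finite point set: new] -/
theorem betaOf_polyPts_mul_factorial {s : ℕ} {r : Fin 3 →₀ ℕ} {a b c : Fin 3} {F : MvPolynomial (Fin 3) K}
    (hne : (polyPts s r a b c F).Nonempty) (hrc : r c = 0) (hrb : ∀ D ∈ F.support, r b ≤ D b) :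
    ∃ n : ℕ, (s.factorial : ℚ) * betaOf (polyPts s r a b c F) = n := by
  classical
  have hv : vertexOf (polyPts s r a b c F) ∈ (F.support.filter fun E => E c < s + r c).image (resPoint s r a b c) :=
    vertexOf_mem hne
  obtain ⟨D, hD, hDv⟩ := Finset.mem_image.mp hv
  rw [Finset.mem_filter] at hD
  obtain ⟨hDF, hDc⟩ := hD
  rw [hrc, add_zero] at hDc
  have hbD := hrb D hDF
  refine ⟨(D b - r b) * (s.factorial / (s - D c)), ?_⟩
  have hdvd : (s - D c) ∣ s.factorial := Nat.dvd_factorial (by omega) (by omega)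
  unfold betaOf
  rw [← hDv]
  unfold resPoint
  simp only [hrc, Nat.cast_zero, add_zero]
  rw [Nat.cast_mul, Nat.cast_div hdvd (by rw [Nat.cast_ne_zero]; omega), Nat.cast_sub hbD, Nat.cast_sub hDc.le]
  have hden : ((s : ℕ) : ℚ) - ((D c : ℕ) : ℚ) ≠ 0 := by
    rw [sub_ne_zero]; exact_mod_cast (by omega : s ≠ D c)
  field_simp

end Summit.ResolutionOfSingularities.ResolutionOfSingularities.Theorems.LossPolygon

namespace Summit.ResolutionOfSingularities.ResolutionOfSingularities.Theorems.LossEpisode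

open Summit.ResolutionOfSingularities.ResolutionOfSingularities.Theorems.LossPolygon

variable {K : Type} [Field K] [DecidableEq K] {q : ℕ} {s₀ : State (Fin 3) K}

/-- **(M0) at a run state: `s! · runBeta ∈ ℕ`** (free letter `l` wall-free, run wall `i` divides by `walk_r`, point set inhabited
because the loss wall is heavy, `q ≤ m + s`). [new] -/
theorem runBeta_mul_factorial (hroot : IsRoot q s₀) (W : ForcedWalk q s₀) {s u : ℕ} {i j l : Fin 3} {k m : ℕ}
    (hS : IsRunState W s u i j l k m) (hm : q ≤ m + s) :
    ∃ n : ℕ, (s.factorial : ℚ) * runBeta W s u i j l = n := by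
  obtain ⟨-, hrj, hrl⟩ := hS.r_apply
  obtain ⟨-, -, hlj, -, -, -, -⟩ := hS
  have hne : (polyPts s (W.st u).r j i l (W.st u).F).Nonempty :=
    polyPts_nonempty_of_heavy_fst hroot W u (Ne.symm hlj) i (by rw [hrj]; omega) hrl
  exact betaOf_polyPts_mul_factorial hne hrl (fun D hD => walk_r hroot W u D hD i)

/-! ## §2 The two open laws, typed on the carrier -/

/-- **LAW (L_X2), local form.**  An X2-arrow from a heavy run state on the tail (`runState_next`, third case: chart of the FREE
letter `l`, `b_u i = 0`, `b_u j ≠ 0`; the successor is the run state `(i, l, j; k, k+m+s−q)`) does not raise `β` — read in the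
successor's own frame `(l, i ; j)`.  OPEN (NODE-g28 §6.4; = chart-transition invariance of the model `β`, F13 (vi)). [new] -/
def LawX2At (W : ForcedWalk q s₀) (N s : ℕ) : Prop :=
  ∀ u : ℕ, N ≤ u → ∀ (i j l : Fin 3) (k m : ℕ), IsRunState W s u i j l k m → q ≤ m + s →
    W.j u = l → W.b u i = 0 → W.b u j ≠ 0 → IsRunState W s (u + 1) i l j k (k + m + s - q) →
    runBeta W s (u + 1) i l j ≤ runBeta W s u i j l

/-- **LAW (L_loss→entry), local form.**  A total loss FROM a heavy run state `t ≥ N` of the lossy tail is followed by SOME later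
heavy run state with strictly smaller `β` (e.g. the entry of the next episode, which exists by `exists_runState_after_loss`).
OPEN (NODE-g28 §6.4 (L_loss)+(L_rep), §6.6 F14). [CJS2020 Lemmas 13.3/13.4 for their algorithm; for the walk: new] -/
def LawLossEntryAt (W : ForcedWalk q s₀) (N s : ℕ) : Prop :=
  ∀ t : ℕ, N ≤ t → ∀ (i j l : Fin 3) (k m : ℕ), IsRunState W s t i j l k m → q ≤ m + s → IsLossMove W t →
    ∃ u : ℕ, t < u ∧ ∃ (i' j' l' : Fin 3) (k' m' : ℕ), IsRunState W s u i' j' l' k' m' ∧ q ≤ m' + s ∧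
      runBeta W s u i' j' l' < runBeta W s t i j l

/-- **LAW (L_X2), closed form** (quantified like `NoRunStateOnLossyTail`). [new] -/
def LawX2 : Prop :=
  ∀ p : ℕ, p.Prime → ∀ e : ℕ, 2 ≤ e → ∀ (K : Type) [Field K] [CharP K p] [PerfectField K] [DecidableEq K]
    (s₀ : State (Fin 3) K), IsRoot (p ^ e) s₀ → ∀ W : ForcedWalk (p ^ e) s₀, ∀ N s : ℕ, TailHyp W N s →
    (∀ M : ℕ, ∃ t, M ≤ t ∧ W.b t ≠ 0) → (∀ (k : Fin 3) (N' : ℕ), ∃ t, N' ≤ t ∧ (W.j t = k ∨ W.b t k ≠ 0)) →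
    (∀ M : ℕ, ∃ t, M ≤ t ∧ IsLossMove W t) → LawX2At W N s

/-- **LAW (L_loss→entry), closed form** (quantified like `NoRunStateOnLossyTail`). [new] -/
def LawLossEntry : Prop :=
  ∀ p : ℕ, p.Prime → ∀ e : ℕ, 2 ≤ e → ∀ (K : Type) [Field K] [CharP K p] [PerfectField K] [DecidableEq K]
    (s₀ : State (Fin 3) K), IsRoot (p ^ e) s₀ → ∀ W : ForcedWalk (p ^ e) s₀, ∀ N s : ℕ, TailHyp W N s →
    (∀ M : ℕ, ∃ t, M ≤ t ∧ W.b t ≠ 0) → (∀ (k : Fin 3) (N' : ℕ), ∃ t, N' ≤ t ∧ (W.j t = k ∨ W.b t k ≠ 0)) →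
    (∀ M : ℕ, ∃ t, M ≤ t ∧ IsLossMove W t) → LawLossEntryAt W N s

/-! ## §3 The assembly: descent on `s! · β` -/

section Descent

variable {W : ForcedWalk q s₀} {N s : ℕ}

/-- **Inside an episode `β` never increases (PROVED from (L_R), (L_X1), assuming (L_X2)).**  From a heavy run state `u ≥ N`, as long
as no total loss has happened, every stage is again a heavy run state (in some frame) with `β ≤ β_u`
(`runState_next_heavy` + `runBeta_R_lt` + `runBeta_X1_le` + `LawX2At`). [new] -/
theorem runState_noLoss_beta_le (hroot : IsRoot q s₀) (hT : TailHyp W N s) (hX2 : LawX2At W N s) {u : ℕ} (hNu : N ≤ u)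
    {i j l : Fin 3} {k m : ℕ} (hS : IsRunState W s u i j l k m) (hm : q ≤ m + s) (d : ℕ)
    (hno : ∀ w, u ≤ w → w < u + d → ¬ IsLossMove W w) :
    ∃ (i' j' l' : Fin 3) (k' m' : ℕ), IsRunState W s (u + d) i' j' l' k' m' ∧ q ≤ m' + s ∧
      runBeta W s (u + d) i' j' l' ≤ runBeta W s u i j l := by
  induction d with
  | zero => exact ⟨i, j, l, k, m, hS, hm, le_rfl⟩
  | succ d ih =>
    obtain ⟨i', j', l', k', m', hS', hm', hβ'⟩ := ih (fun w hw hw' => hno w hw (by omega))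
    have hnl : ¬ IsLossMove W (u + d) := hno (u + d) (by omega) (by omega)
    obtain ⟨hq, -, -, hnext⟩ := runState_next_heavy hroot hT (u := u + d) (by omega) hS' hm'
    rcases hnext with ⟨hju, hbu, hS''⟩ | ⟨hju, hbi, hm'', hS''⟩ | ⟨hju, hbi, hbj, hm'', hS''⟩ | ⟨-, hloss, -⟩
    · exact ⟨i', j', l', k' + m' + s - q, m', hS'', hm',
        (runBeta_R_lt hroot W hS' hm' hq.le hju hbu hS'').le.trans hβ'⟩
    · exact ⟨i', j', l', k', k' + m' + s - q, hS'', hm'', (runBeta_X1_le hroot W hS' hm' hq.le hju hbi hS'').trans hβ'⟩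
    · exact ⟨i', l', j', k', k' + m' + s - q, hS'', hm'', (hX2 (u + d) (by omega) i' j' l' k' m' hS' hm' hju hbi hbj hS'').trans hβ'⟩
    · exact absurd hloss hnl

/-- **Follow the episode to its loss (PROVED, assuming (L_X2)).**  If total losses recur, a heavy run state `u ≥ N` is followed by a
stage `t ≥ u` which is a heavy run state with `β_t ≤ β_u` AND at which the move is a total loss. [new] -/
theorem runState_until_loss (hroot : IsRoot q s₀) (hT : TailHyp W N s) (hX2 : LawX2At W N s)
    (hlossy : ∀ M : ℕ, ∃ t, M ≤ t ∧ IsLossMove W t) {u : ℕ} (hNu : N ≤ u)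
    {i j l : Fin 3} {k m : ℕ} (hS : IsRunState W s u i j l k m) (hm : q ≤ m + s) :
    ∃ t : ℕ, u ≤ t ∧ IsLossMove W t ∧ ∃ (i' j' l' : Fin 3) (k' m' : ℕ), IsRunState W s t i' j' l' k' m' ∧ q ≤ m' + s ∧
      runBeta W s t i' j' l' ≤ runBeta W s u i j l := by
  classical
  have hex : ∃ d : ℕ, IsLossMove W (u + d) := by
    obtain ⟨t, hut, ht⟩ := hlossy u
    exact ⟨t - u, by rw [Nat.add_sub_cancel' hut]; exact ht⟩
  let d := Nat.find hex
  have hd : IsLossMove W (u + d) := Nat.find_spec hex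
  have hmin : ∀ w, u ≤ w → w < u + d → ¬ IsLossMove W w := by
    intro w hw hw' hl
    have h := Nat.find_min hex (m := w - u) (by omega)
    rw [Nat.add_sub_cancel' hw] at h
    exact h hl
  obtain ⟨i', j', l', k', m', hS', hm', hβ'⟩ := runState_noLoss_beta_le hroot hT hX2 hNu hS hm d hmin
  exact ⟨u + d, by omega, hd, i', j', l', k', m', hS', hm', hβ'⟩

end Descent

/-- **THE ASSEMBLY (PROVED): (L_X2) ∧ (L_loss→entry) ⇒ `NoRunStateOnLossyTail`.**  Infinite descent on `s!·β ∈ ℕ`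
(`runBeta_mul_factorial`): from a heavy run state follow the episode to its loss (`runState_until_loss`, `β` not increased), then
the entry law gives a later heavy run state with `s!·β` strictly smaller. [NODE-g28 §6.4 F12; new] -/
theorem noRunStateOnLossyTail_of_laws (hX2 : LawX2) (hL : LawLossEntry) : NoRunStateOnLossyTail := by
  intro p hp e he K _ _ _ _ s₀ hroot W N s hT hb hcoord hlossy u hNu i j l k m hm hS
  have hX2' : LawX2At W N s := hX2 p hp e he K s₀ hroot W N s hT hb hcoord hlossy
  have hL' : LawLossEntryAt W N s := hL p hp e he K s₀ hroot W N s hT hb hcoord hlossy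
  suffices H : ∀ v : ℕ, ∀ u : ℕ, N ≤ u → ∀ (i j l : Fin 3) (k m : ℕ), IsRunState W s u i j l k m → p ^ e ≤ m + s →
      ((s.factorial : ℕ) : ℚ) * runBeta W s u i j l = v → False by
    obtain ⟨n, hn⟩ := runBeta_mul_factorial hroot W hS hm
    exact H n u hNu i j l k m hS hm hn
  intro v
  induction v using Nat.strong_induction_on with
  | _ v ih =>
    intro u hNu i j l k m hS hm hv
    obtain ⟨t, hut, hloss, i₁, j₁, l₁, k₁, m₁, hS₁, hm₁, hβ₁⟩ := runState_until_loss hroot hT hX2' hlossy hNu hS hm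
    obtain ⟨u', htu', i', j', l', k', m', hS', hm', hβ'⟩ := hL' t (by omega) i₁ j₁ l₁ k₁ m₁ hS₁ hm₁ hloss
    obtain ⟨n', hn'⟩ := runBeta_mul_factorial hroot W hS' hm'
    have hlt : ((s.factorial : ℕ) : ℚ) * runBeta W s u' i' j' l' < ((s.factorial : ℕ) : ℚ) * runBeta W s u i j l :=
      mul_lt_mul_of_pos_left (lt_of_lt_of_le hβ' hβ₁) (by exact_mod_cast Nat.factorial_pos s)
    rw [hn', hv] at hlt
    exact ih n' (by exact_mod_cast hlt) u' (by omega) i' j' l' k' m' hS' hm' hn'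

/-- **Corollary (PROVED): the located residual from the two laws.** [new] -/
theorem noLossyStrictTailsDeep_of_laws (hX2 : LawX2) (hL : LawLossEntry) : NoLossyStrictTailsDeep :=
  noLossyStrictTailsDeep_of_noRunStateOnLossyTail (noRunStateOnLossyTail_of_laws hX2 hL)

end Summit.ResolutionOfSingularities.ResolutionOfSingularities.Theorems.LossEpisode
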